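import Summits.CriticalPhenomena.PercolationContinuityZ3.Theorems.Transplant.SkelNeg1RootGlueTA
import Summits.CriticalPhenomena.PercolationContinuityZ3.Theorems.Transplant.SkelNeg1RootHoldsXEA
import Summits.CriticalPhenomena.PercolationContinuityZ3.Theorems.Transplant.SkelNeg1RootHoldsYE
import Summits.CriticalPhenomena.PercolationContinuityZ3.Theorems.Transplant.SkelNegBParamsResidualsAF
import HarnessLib

/-!
# N1 (the `{±1}` node), (R) column under (ζ′) + the L closure, **slot-ledger (ζ′) v2**: **THE LAW-CARRYING, LENGTH-BUDGETED ROOT OBLIGATION OF THE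
# (ζ′) v2 CHOICE FUNCTION** — `rootHoldsNOWFnL_negChoiceAllOTA_F (c Px mx) :
#   RootHoldsNOWFnL NegB.LfA (negChoiceAllOTA (KS.gT 0 (KS.gxA c)) (KS.fT 0 KS.fxA) (KS.PR 0 Px) (SUA (exAF c) mx))`
# — the (R) wrapper RE-POINTED from `ex := exA` (v1, `rootHoldsNOWFnL_negChoiceAllOTA`, SkelNeg1RootHoldsA, which stays as landed) to the v2 residual
# slot `ex := exAF c := exA + (r₀A 0 (RBF c 0) + 1)` (stmt-g16 2026-08-22T08:18:43Z, ResidualsAF; lead 08:17:44Z NAME RULE: new declaration `_F`, new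
# file).  The x-family is the ex-generic `NegB.rootOblTWAt_negBTA_x_ex` (SkelNeg1RootHoldsXEA) and the y′-family the ex-generic
# `NegB.rootOblTWAt_negBTA_y_ex` (SkelNeg1RootHoldsYE), both at `ex := exAF c`: the nine (R) floors are `floors_exAF c` and the `×Kq` run floor is
# `floorsK_exA.1` transported along `exA ≤ exAF c` (`(exAF_eq …).2`); the two `×Kq` floors `2000·Kq·(RA′+2) ≤ 2400·Kq·(RA′+2) ≤ n_L` /
# `22000·Kq·(RA′+2) ≤ 30000·Kq·(RA′+2) ≤ M_L` and the box-residual floor `64·(n_b + ℓ_b + |h_b|) ≤ M_L` are `KS.nL_floorsA.1` / `KS.ML_floorsA.1` /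
# `KS.ML_floorsA.2.1` exactly as in v1; glued by `rootHoldsNOWFnL_negChoiceAllOTA_of_xy` (SkelNeg1RootGlueTA).  Also recorded: the two families at
# `exAF c` by name (`NegB.rootOblTWAt_negBTA_x_exAF`, `NegB.rootOblTWAt_negBTA_y_exAF`).

builds on p205010 (kernel theorem, internal audit signed; external expert review pending) — nothing here uses it; NOTHING is claimed about the open node
`SamePDropOfSkeletonNeg₁`: this is ONE of the four hypotheses of `samePDropOfSkeletonNeg₁_of_choiceFnNOWL NegB.LfA (negChoiceAllOTA …)` at the v2 tuple
(the node₁ file `SkelNeg1HoldsAllL` meets the (F) and (C) wrappers at the same tuple).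
Lane `prim-bschramm`, seat `prim-bschramm-p3` (gen 12; design owner + (R) owner); helper file (`--supports stmt-CriticalPhenomena-4575 --as helper`).
[cite: KozmaNitzan2024, §4 p. 28 ((32) at the root)]
-/

noncomputable section

open scoped Classical

namespace Summit.CriticalPhenomena.PercolationContinuityZ3.Theorems.Transplant

open MeasureTheory Literature.Probability.Percolation Literature.Probability.LatticeModels SimpleGraph KNCells KNLevels

namespace PlanarSkeletonNeg

open SkelConc (Consts)
open Skelφ.StepI (DataN OutO eventNAt)

namespace NegB

open Neg

section AtR

variable {κ : Consts} {V : Type} [DecidableEq V] [Countable V] {G : SimpleGraph V} [G.LocallyFinite] {Φ : PlanarSkeletonNeg G} {t : V}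
  {p : unitInterval} {hC : Φ.CylSubcritical p} (gx fx : Neg.FSlot) (Px : PSlot) (mx : GSlot) (c : ℕ) {O : OutO V} {q : unitInterval}

set_option maxHeartbeats 1600000 in
/-- **The x-family at the v2 residual slot `exAF c`** (`NegB.rootOblTWAt_negBTA_x_ex` at `ex := exAF c`; floors `floors_exAF`, run floor
`floorsK_exA.1` transported). [cite: KozmaNitzan2024, §4 p. 28 ((32) at the root)] -/
theorem rootOblTWAt_negBTA_x_exAF (hAt : (choiceAtOTA κ Φ t p (KS.gT 0 gx) (KS.fT 0 fx) (SUA (exAF c) mx) hC (KS.PR 0 Px)).AtQO O q)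
    (h1 : Φ.types = {t}) (hp0 : 0 < (p : ℝ)) (hp1 : (p : ℝ) < 1) (hflat : FlatL LfA κ) (du : MDir) (hd : du.1 = 0)
    (hnA : 2000 * Neg.Kq κ * (KS.RA' κ Φ t p O.merged 0 + 2) ≤ nL κ Φ t p O.merged (KS.gT 0 gx κ Φ t p O.merged) (KS.fT 0 fx κ Φ t p O.merged))
    (hMA : 22000 * Neg.Kq κ * (KS.RA' κ Φ t p O.merged 0 + 2) ≤ ML κ Φ t p O.merged (KS.gT 0 gx κ Φ t p O.merged)) :
    Skel.RootOblTWAt G ((choiceAtOTA κ Φ t p (KS.gT 0 gx) (KS.fT 0 fx) (SUA (exAF c) mx) hC (KS.PR 0 Px)).scheme O q) Φ.Δ κ.δr du :=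
  rootOblTWAt_negBTA_x_ex gx fx Px mx (exAF c) hAt h1 hp0 hp1 hflat du hd hnA hMA (floors_exAF κ Φ t p O.merged c _ _)
    ((floorsK_exA κ Φ t p O.merged _ _).1.trans (exAF_eq κ Φ t p O.merged c _ _).2)

set_option maxHeartbeats 1600000 in
/-- **The y′-family at the v2 residual slot `exAF c`** (`NegB.rootOblTWAt_negBTA_y_ex` at `ex := exAF c`; `exA ≤ exAF c` is `(exAF_eq …).2`).
[cite: KozmaNitzan2024, §4 p. 28 ((32) at the root)] -/
theorem rootOblTWAt_negBTA_y_exAF (hAt : (choiceAtOTA κ Φ t p (KS.gT 0 gx) (KS.fT 0 fx) (SUA (exAF c) mx) hC (KS.PR 0 Px)).AtQO O q)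
    (h1 : Φ.types = {t}) (hp0 : 0 < (p : ℝ)) (hp1 : (p : ℝ) < 1) (hflat : FlatL LfA κ) (du : MDir) (hd : du.1 = 1)
    (hnA : 2000 * Neg.Kq κ * (KS.RA' κ Φ t p O.merged 0 + 2) ≤ nL κ Φ t p O.merged (KS.gT 0 gx κ Φ t p O.merged) (KS.fT 0 fx κ Φ t p O.merged))
    (hMA : 22000 * Neg.Kq κ * (KS.RA' κ Φ t p O.merged 0 + 2) ≤ ML κ Φ t p O.merged (KS.gT 0 gx κ Φ t p O.merged))
    (hS64 : 64 * (KS.nBR κ Φ t p O.merged 0 + KS.ℓBR κ Φ t p O.merged 0 + (KS.hBR κ Φ t p O.merged 0).natAbs) ≤ ML κ Φ t p O.merged (KS.gT 0 gx κ Φ t p O.merged)) :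
    Skel.RootOblTWAt G ((choiceAtOTA κ Φ t p (KS.gT 0 gx) (KS.fT 0 fx) (SUA (exAF c) mx) hC (KS.PR 0 Px)).scheme O q) Φ.Δ κ.δr du :=
  rootOblTWAt_negBTA_y_ex gx fx Px mx (exAF c) hAt h1 hp0 hp1 hflat du hd hnA hMA hS64 (exAF_eq κ Φ t p O.merged c _ _).2
    (floors_exAF κ Φ t p O.merged c _ _) ((floorsK_exA κ Φ t p O.merged _ _).1.trans (exAF_eq κ Φ t p O.merged c _ _).2)

end AtR

end NegB

set_option maxHeartbeats 1600000 in
/-- **`RootHoldsNOWFnL NegB.LfA` of the (ζ′) v2 choice function** (`gx := KS.gxA c`, `fx := KS.fxA`, `ex := exAF c`; any `c Px mx`) — the v1 wrapper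
`rootHoldsNOWFnL_negChoiceAllOTA` re-pointed to `exAF c` (slot-ledger (ζ′) v2). [cite: KozmaNitzan2024, §4 p. 28 ((32) at the root)] -/
theorem rootHoldsNOWFnL_negChoiceAllOTA_F (c : ℕ) (Px : NegB.PSlot) (mx : NegB.GSlot) :
    RootHoldsNOWFnL NegB.LfA
      (negChoiceAllOTA (NegB.KS.gT 0 (NegB.KS.gxA c)) (NegB.KS.fT 0 NegB.KS.fxA) (NegB.KS.PR 0 Px) (NegB.SUA (NegB.exAF c) mx)) :=
  rootHoldsNOWFnL_negChoiceAllOTA_of_xy _ _ _ _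
    (fun κ _ _ _ _ _ Φ t p _ O _ hAt h1 hp0 hp1 hflat du hd =>
      NegB.rootOblTWAt_negBTA_x_exAF (NegB.KS.gxA c) NegB.KS.fxA Px mx c hAt h1 hp0 hp1 hflat du hd
        -- `2000·Kq·(RA′+2) ≤ 2400·Kq·(RA′+2) ≤ n_L` and `22000·Kq·(RA′+2) ≤ 30000·Kq·(RA′+2) ≤ M_L`
        (le_trans (Nat.mul_le_mul_right _ (Nat.mul_le_mul_right _ (by norm_num)))
          (NegB.KS.nL_floorsA κ Φ t p O.merged (NegB.KS.gT 0 (NegB.KS.gxA c) κ Φ t p O.merged)).1)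
        (le_trans (Nat.mul_le_mul_right _ (Nat.mul_le_mul_right _ (by norm_num))) (NegB.KS.ML_floorsA κ Φ t p O.merged c).1))
    (fun κ _ _ _ _ _ Φ t p _ O _ hAt h1 hp0 hp1 hflat du hd =>
      NegB.rootOblTWAt_negBTA_y_exAF (NegB.KS.gxA c) NegB.KS.fxA Px mx c hAt h1 hp0 hp1 hflat du hd
        (le_trans (Nat.mul_le_mul_right _ (Nat.mul_le_mul_right _ (by norm_num)))
          (NegB.KS.nL_floorsA κ Φ t p O.merged (NegB.KS.gT 0 (NegB.KS.gxA c) κ Φ t p O.merged)).1)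
        (le_trans (Nat.mul_le_mul_right _ (Nat.mul_le_mul_right _ (by norm_num))) (NegB.KS.ML_floorsA κ Φ t p O.merged c).1)
        -- `64·(n_b + ℓ_b + |h_b|) ≤ M_L` at `gxA c`
        (NegB.KS.ML_floorsA κ Φ t p O.merged c).2.1)

end PlanarSkeletonNeg

end Summit.CriticalPhenomena.PercolationContinuityZ3.Theorems.Transplant

end
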